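/-
Copyright (c) 2026 the pub-hodgecm-mathlib formalisation cell (harness21).  Prover seat hodgecm-mathlib-K2E3-p17 (g8), Track B «K2-LIT» ∕ h413
(`stmt-HodgeConjecture-24833`), line `K2_E3_EllipticInputs`, leaf (nsc-S-A′), D94 sub-brick S1 (GL2-LINKED) part (a): the `n = 2` analogue of ★ E4a
(`K2E3GL3PrincipalSeriesConstituentsJacquetNonzero`, K2E3-p24 (g0)), WITHOUT any cell hypothesis.  2026-09-04.
-/
import Summits.HodgeConjecture.HodgeConjecture.Theorems.K2E3GL3PrincipalSeriesConstituentsJacquetNonzero   -- ★ E4a: the `n = 3` template and its kit (Casselman 5.4.3, HC criterion, admissibility)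
import Summits.HodgeConjecture.HodgeConjecture.Theorems.K2E3GL2JacquetRelabel                              -- ★ `unipotentRadicalGL_id_eq_lastBlockLabel_two`, `coinvariantsKer_restrictUnipotentGL_eq`; brings ★ `K2E3GL2BorelRelabelEquiv.exists_equiv_parabolicIndGL_id_lastBlockLabel_two`
import Literature.NumberTheory.Automorphic.IrreducibleClassesConstituents                                 -- ★ `IrrClass.isConstituentOf_congr`
import HarnessLib

/-!
# Crux `H413` — leaf (nsc-S-A′), sub-brick S1(a): CONSTITUENTS OF A PRINCIPAL SERIES OF `GL₂(F)` HAVE A NON-ZERO JACQUET MODULE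

Cell `hodgecm-mathlib`, Track B; THEOREMS ONLY; count-neutral helper (`--supports stmt-HodgeConjecture-24833 --as helper`).

For `GL₂` the only proper standard parabolic is the Borel, so Harish-Chandra's criterion (★ `isSupercuspidal_iff_jacquetGL_holds`) says: an irreducible smooth `r` with
`r_B(r) = 0` is SUPERCUSPIDAL; and Casselman's Cor. 5.4.3 (★ `intertwiningMap_subrepresentation_parabolicIndGL_eq_zero`) says a supercuspidal is not a subquotient of an
induced `i_c σ` for a one-dimensional `σ`.  Hence **`nontrivial_coinvariants_of_isConstituentOf_principalSeries_two`**: every constituent `r` of `I(σ) = parabolicIndGL F c σ`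
(`σ : M_c → GL(ℂ)` any character-type representation on `ℂ`, `c` monotone with proper blocks — `lastBlockLabel 2` or `id`) has `r_B(r) ≠ 0`; NO cell hypothesis (contrast ★ E4a's
`h3cell` at `n = 3`).  Forms: `id`-currency, `lastBlockLabel 2`-currency (`…_lastBlockLabel`), and the hypothesis shape of ★ `JacquetRankStrictMono`
(`forall_isConstituentOf_nontrivial_restrict_two`: `∀ c, c.IsConstituentOf I → ∃ r, IrrClass.mk r = c ∧ Nontrivial ((parabolicTripleGL F c′).restrict r.ρ).Coinvariants`), which
feeds ★ `finrank_coinvariants_eq_one_of_ne_bot_of_ne_top` ∕ `not_bot_lt_lt_lt_top_of_finrank_coinvariants_le_two` (length ≤ 2 of `I₂`, used by S1(b) GL2-LINKED).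

HONEST LABEL: HC_CM is proved only modulo the 7 printed citations (2 remaining named inputs: hLiu418 = stmt-HodgeConjecture-24832, h413 =
stmt-HodgeConjecture-24833) until rung 0 closes; count-neutral helper.

## References
* [BernsteinZelevinsky1977] I. N. Bernstein, A. V. Zelevinsky, *Induced representations of reductive p-adic groups I*, Ann. Sci. ÉNS 10 (1977), Thm. 2.5, Thm. 2.9, §2.4.
* [Casselman1995] W. Casselman, *Introduction to the theory of admissible representations of p-adic reductive groups* (draft 1995), Cor. 5.4.3, Thm. 6.3.7.
-/

set_option autoImplicit false
-- the mandated namespace repeats `HodgeConjecture.HodgeConjecture`, as in every `Theorems/*.lean` of this sub-problem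
set_option linter.dupNamespace false

noncomputable section

open scoped MatrixGroups
open Literature.NumberTheory.Automorphic Literature.NumberTheory.Automorphic.Zelevinsky1980 Literature.RepresentationTheory.FiniteGroups Representation
open Summit.HodgeConjecture.HodgeConjecture.Cruxes.H413.K2E3TwoBlockCuspidalSupportEmbedding (eq_id_of_monotone_surjective)

namespace Summit.HodgeConjecture.HodgeConjecture.Cruxes.H413.K2E3GL2PrincipalSeriesConstituentsJacquetNonzero

variable {F : Type} [Field F] [ValuativeRel F] [TopologicalSpace F] [IsNonarchimedeanLocalField F]

/-- **(S1a) A CONSTITUENT OF AN INDUCED-FROM-A-CHARACTER REPRESENTATION OF `GL₂(F)` HAS `r_B ≠ 0`.**  `c : Fin 2 → Fin k` monotone with proper blocks (the Borel under any `Fin`-labelling; the `Bool`-labelled `I₂ x y` below),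
`σ` a representation of the block Levi on `ℂ` (no continuity needed), `r` an irreducible smooth constituent of `parabolicIndGL F c σ`: then the Borel Jacquet module
`(restrictUnipotentGL F id r.ρ).Coinvariants` is non-zero.  (If it vanished, `r` would be supercuspidal by Harish-Chandra — for `GL₂` the Borel is the only proper parabolic — and
Casselman's Cor. 5.4.3 forbids a supercuspidal subquotient of `i_c σ`.) [cite: BernsteinZelevinsky1977, Thm. 2.5, Thm. 2.9] [cite: Casselman1995, Cor. 5.4.3, Thm. 6.3.7] -/
theorem nontrivial_coinvariants_of_isConstituentOf_induced_two {k : ℕ} (c : Fin 2 → Fin k) (hcm : Monotone c) (hcp : IsProperBlocks c)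
    (σ : Representation ℂ (Π a, GL {i : Fin 2 // c i = a} F) ℂ) (r : SmoothIrrep (GL (Fin 2) F)) (hr : (IrrClass.mk r).IsConstituentOf (parabolicIndGL F c σ)) :
    Nontrivial (restrictUnipotentGL F (id : Fin 2 → Fin 2) r.ρ).Coinvariants := by
  classical
  haveI : IsTopologicalRing F := inferInstance
  haveI : r.ρ.IsIrreducible := r.isIrreducible
  have hra : r.ρ.IsAdmissible := jacquetAdmissibility_gl_holds F 2 r.V r.ρ r.isSmooth r.isIrreducible
  -- unpack the constituent: a surjection `q₁ : N₁ ↠ r`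
  obtain ⟨r', hr', N₁, N₂, hle, ⟨e⟩⟩ := hr
  obtain ⟨e₁⟩ := (IrrClass.mk_eq_mk_iff r' r).1 hr'
  let mkQ' : N₁.toRepresentation.IntertwiningMap
      (N₁.toRepresentation.quotient (N₂.toSubmodule.comap N₁.toSubmodule.subtype) fun g _ hx => N₂.apply_mem_toSubmodule g hx) :=
    { toLinearMap := (N₂.toSubmodule.comap N₁.toSubmodule.subtype).mkQ
      isIntertwining' := fun _ => rfl }
  have hmkQ' : Function.Surjective mkQ' := Submodule.mkQ_surjective _
  let q₁ : N₁.toRepresentation.IntertwiningMap r.ρ := e₁.toIntertwiningMap.comp (e.symm.toIntertwiningMap.comp mkQ')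
  have hq₁ : Function.Surjective q₁ := by
    intro v
    obtain ⟨x, hx⟩ := hmkQ' (e (e₁.symm v))
    refine ⟨x, ?_⟩
    simp only [q₁, IntertwiningMap.comp_apply, hx]
    change e₁ (e.symm (e (e₁.symm v))) = v
    rw [e.symm_apply_apply, e₁.apply_symm_apply]
  have hq₁0 : q₁ ≠ 0 := by
    haveI : Nontrivial r.V := IsIrreducible.nontrivial r.ρ
    intro h
    obtain ⟨v, hv⟩ := exists_ne (0 : r.V)
    obtain ⟨x, hx⟩ := hq₁ v
    rw [h] at hx
    exact hv (hx ▸ rfl)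
  -- suppose the Borel Jacquet module vanishes: then every proper Jacquet module vanishes (the Borel is the only proper parabolic), so `r` is supercuspidal
  by_contra hB
  rw [not_nontrivial_iff_subsingleton] at hB
  have hsc : r.ρ.IsSupercuspidal := by
    rw [isSupercuspidal_iff_jacquetGL_holds F r.ρ r.isSmooth]
    intro k' c' hc'p hc'm
    obtain ⟨hcs, hknt⟩ := hc'p
    have hk2 : k' ≤ 2 := by simpa using Fintype.card_le_of_surjective c' hcs
    have hk2' : 2 ≤ k' := by
      have h := Fintype.one_lt_card_iff_nontrivial.2 hknt
      simp only [Fintype.card_fin] at h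
      omega
    obtain rfl : k' = 2 := le_antisymm hk2 hk2'
    obtain rfl : c' = id := eq_id_of_monotone_surjective hc'm hcs
    exact hB
  -- Casselman's Cor. 5.4.3 kills `q₁`
  have hσZ : ∀ u : Fˣ, ∃ cu : ℂ, ∀ w : ℂ, σ (leviProjection F c ⟨_, scalar_mem_standardParabolicGL c u⟩) w = cu • w :=
    fun u => ⟨σ (leviProjection F c ⟨_, scalar_mem_standardParabolicGL c u⟩) 1, fun w => by
      rw [smul_eq_mul, mul_comm, ← smul_eq_mul, ← map_smul, smul_eq_mul, mul_one]⟩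
  exact hq₁0 (intertwiningMap_subrepresentation_parabolicIndGL_eq_zero hcm hcp hσZ hra hsc N₁ q₁)

/-- **(S1a) FOR `I₂ x y`** (★ G1∕PEEL currency `parabolicIndGL F (lastBlockLabel 2) (𝟙.twist (maxParabolicLeviChar F 2 x y))`): every constituent `r` has a non-zero Borel Jacquet
module — transport of the `id`-labelled case along ★ `K2E3GL2BorelRelabelEquiv.exists_equiv_parabolicIndGL_id_lastBlockLabel_two` (★ `isConstituentOf_congr`).
[cite: BernsteinZelevinsky1977, Thm. 2.5] [cite: Casselman1995, Cor. 5.4.3, Thm. 6.3.7] -/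
theorem nontrivial_coinvariants_of_isConstituentOf_principalSeries_two (x y : Fˣ →* ℂˣ) (r : SmoothIrrep (GL (Fin 2) F))
    (hr : (IrrClass.mk r).IsConstituentOf (Representation.parabolicIndGL F (lastBlockLabel 2) ((Representation.trivial ℂ (Π a : Bool, GL {i : Fin 2 // lastBlockLabel 2 i = a} F) ℂ).twist (maxParabolicLeviChar F 2 x y)))) :
    Nontrivial (restrictUnipotentGL F (id : Fin 2 → Fin 2) r.ρ).Coinvariants := by
  obtain ⟨Φ, -⟩ := K2E3GL2BorelRelabelEquiv.exists_equiv_parabolicIndGL_id_lastBlockLabel_two (F := F) x y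
  have hr' : (IrrClass.mk r).IsConstituentOf (Representation.parabolicIndGL F (id : Fin 2 → Fin 2) ((Representation.trivial ℂ (Π a : Fin 2, GL {i : Fin 2 // (id : Fin 2 → Fin 2) i = a} F) ℂ).twist (∏ a : Fin 2, ((![x, y] : Fin 2 → (Fˣ →* ℂˣ)) a).comp (Matrix.GeneralLinearGroup.det.comp (Pi.evalMonoidHom (fun a : Fin 2 => GL {i : Fin 2 // (id : Fin 2 → Fin 2) i = a} F) a))))) := (IrrClass.isConstituentOf_congr Φ _).2 hr
  exact nontrivial_coinvariants_of_isConstituentOf_induced_two (id : Fin 2 → Fin 2) monotone_id ⟨Function.surjective_id, inferInstance⟩ _ r hr'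

/-- **(S1a) for `I₂ x y`, `lastBlockLabel 2`-currency of the Jacquet module** (`restrictUnipotentGL F (lastBlockLabel 2) r.ρ`; same kernel, ★
`K2E3GL2JacquetRelabel.unipotentRadicalGL_id_eq_lastBlockLabel_two`). [cite: BernsteinZelevinsky1977, Thm. 2.5] [cite: Casselman1995, Cor. 5.4.3] -/
theorem nontrivial_coinvariants_lastBlockLabel_of_isConstituentOf_principalSeries_two (x y : Fˣ →* ℂˣ) (r : SmoothIrrep (GL (Fin 2) F))
    (hr : (IrrClass.mk r).IsConstituentOf (Representation.parabolicIndGL F (lastBlockLabel 2) ((Representation.trivial ℂ (Π a : Bool, GL {i : Fin 2 // lastBlockLabel 2 i = a} F) ℂ).twist (maxParabolicLeviChar F 2 x y)))) :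
    Nontrivial (restrictUnipotentGL F (lastBlockLabel 2) r.ρ).Coinvariants := by
  have h := nontrivial_coinvariants_of_isConstituentOf_principalSeries_two x y r hr
  have hker := K2E3GL2JacquetRelabel.coinvariantsKer_restrictUnipotentGL_eq (id : Fin 2 → Fin 2) (lastBlockLabel 2)
    K2E3GL2JacquetRelabel.unipotentRadicalGL_id_eq_lastBlockLabel_two r.ρ
  rw [← not_subsingleton_iff_nontrivial] at h ⊢
  intro hs
  apply h
  change Subsingleton (r.V ⧸ Coinvariants.ker (restrictUnipotentGL F (id : Fin 2 → Fin 2) r.ρ))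
  rw [hker]
  exact hs

/-- **(S1a) in the hypothesis shape of ★ `JacquetRankStrictMono`** (`t := parabolicTripleGL F (id : Fin 2 → Fin 2)`): every constituent of `I₂ x y` has a non-zero abstract Jacquet
module `(t.restrict r.ρ).Coinvariants` (same kernel as `restrictUnipotentGL F id`, ★ `jacquetGLEquiv`).  Feeds ★ `finrank_coinvariants_eq_one_of_ne_bot_of_ne_top`,
`not_bot_lt_lt_lt_top_of_finrank_coinvariants_le_two`, `nontrivial_coinvariants_of_forall_isConstituentOf` (length ≤ 2 of `I₂ x y`). [cite: BernsteinZelevinsky1977, Thm. 2.5]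
[cite: Casselman1995, Cor. 6.3.7, Prop. 7.1.3] -/
theorem forall_isConstituentOf_principalSeries_two_nontrivial_restrict (x y : Fˣ →* ℂˣ) :
    ∀ cl : IrrClass (GL (Fin 2) F), cl.IsConstituentOf (Representation.parabolicIndGL F (lastBlockLabel 2) ((Representation.trivial ℂ (Π a : Bool, GL {i : Fin 2 // lastBlockLabel 2 i = a} F) ℂ).twist (maxParabolicLeviChar F 2 x y))) →
      ∃ r : SmoothIrrep (GL (Fin 2) F), IrrClass.mk r = cl ∧ Nontrivial ((parabolicTripleGL F (id : Fin 2 → Fin 2)).restrict r.ρ).Coinvariants := by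
  intro cl hcl
  induction cl using Quotient.inductionOn with
  | h r =>
    refine ⟨r, rfl, ?_⟩
    haveI := nontrivial_coinvariants_of_isConstituentOf_principalSeries_two x y r hcl
    exact (EquivLike.injective (jacquetGLEquiv F (id : Fin 2 → Fin 2) r.ρ)).nontrivial

end Summit.HodgeConjecture.HodgeConjecture.Cruxes.H413.K2E3GL2PrincipalSeriesConstituentsJacquetNonzero

end
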